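import Summits.AnomalousDissipation.AnomalousDissipation.Theorems.BaireTransferDenseLoudDesignerForcesErgodicLinearisedBridge
import Literature.Analysis.FluidPDE.TorusLinearisedNSSmoothing
import Literature.Dynamics.Hyperbolic.GrowthRates

/-!
# Rate transfer between the `H` and `V` norms of the linearised flow (tools stub `stub_linearisedRateTransferTools`,
# block N-A, line `ergodic-budget-selection-closing`, crux `BaireTransfer.DenseLoudDesignerForces`, stmt-AnomalousDissipation-1143)

Summit-side glue (sorry-free) between the line's `L²` growth notions `ExpDecay w`, `SubExpGrowth w` of a linearised
solution `w` at the integer times (file `…ErgodicLine.lean`, §2) and the real-sequence notions `SeqExpDecay`,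
`SeqSubExpGrowth` of `Literature/Dynamics/Hyperbolic/HyperbolicSemiflowModel.lean` applied to the `H¹ = V` quantity
`n ↦ ‖w(n)‖₂² + ‖∇w(n)‖₂²` (the model norm of the smooth model of block N):

* `IsLinearizedNSSolutionOn.mono` — restriction of a linearised solution to a smaller time set of unique
  differentiability (`Torus.linearisedNS_mono`);
* `exists_linearised_sq_add_gradNormSq_add_one_le` — ONE-STEP `H → V` SMOOTHING WITH `L²` GROWTH: for `ν > 0`, a level
  `M` and gradient levels `Cᵢ` there is `K ≥ 0` such that along every classical solution `u` of NS_ν(F) on `[0,∞) × T³`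
  with `‖u‖ ≤ M`, `‖∂ᵢu‖ ≤ Cᵢ`, every linearised solution satisfies `‖w(a+1)‖₂² + ‖∇w(a+1)‖₂² ≤ K ‖w(a)‖₂²` for all
  `a ≥ 0` (`Torus.linearisedNS_sub_mul_gradNormSq_le` on `[a, a+1]`, Constantin–Foias 1988 Ch. 14 "`S'(t,u₀)` maps `H`
  into `V` boundedly", plus the Grönwall bound `Torus.linearisedNS_integral_norm_sq_le_mul_exp_of_mem`);
* `stub_linearisedRateTransferTools` — the registered tools stub A2, proved BY NAME with exactly the registered
  signature: `ExpDecay w → SeqExpDecay (n ↦ ‖w(n)‖₂² + ‖∇w(n)‖₂²)` (`SeqExpDecay.of_succ_le`) and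
  `SeqSubExpGrowth (n ↦ ‖w(n)‖₂² + ‖∇w(n)‖₂²) → SubExpGrowth w` (`SeqSubExpGrowth.of_le`).

References: P. Constantin, C. Foias, *Navier–Stokes Equations* (1988) Ch. 14 (14.2)–(14.4), Prop. 13.2;
L. Barreira, Ya. Pesin, *Introduction to Smooth Ergodic Theory* (2023) Ch. 2 (Lyapunov exponents under a change of norm).
-/

-- `Summit.<Summit>.<Problem>` is the tree's mandated summit-side namespace (CONVENTIONS §2); for this
-- single-conjunct summit the two coincide, so the duplicate is deliberate.
set_option linter.dupNamespace false

noncomputable section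

open scoped BigOperators Topology ENNReal InnerProductSpace
open Filter Set Function MeasureTheory

namespace Summit.AnomalousDissipation.AnomalousDissipation.Theorems.DenseLoudDesignerForces.Ergodic

open Literature.Analysis.FunctionSpaces Literature.Analysis.FunctionSpaces.Torus
open Literature.Analysis.FluidPDE Literature.Analysis.FluidPDE.Torus
open Literature.Dynamics.Hyperbolic

section RateTransfer

variable {ν : ℝ} {u w : ℝ → (UnitAddTorus (Fin 3)) → (EuclideanSpace ℝ (Fin 3))} {q : ℝ → (UnitAddTorus (Fin 3)) → ℝ}

/-- **Restriction of the time set for linearised solutions.** A solution of the linearised Navier–Stokes system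
along `u` on `S` (`IsLinearizedNSSolutionOn`) is one on every `S' ⊆ S` of unique differentiability: joint
smoothness, `div w = 0` and the zero mean restrict, and the one-sided time derivative within `S'` agrees with the
one within `S` (`Torus.linearisedNS_mono`). [folklore] -/
theorem IsLinearizedNSSolutionOn.mono {S S' : Set ℝ} (h : IsLinearizedNSSolutionOn S ν u w q) (hS' : S' ⊆ S)
    (hU : UniqueDiffOn ℝ S') : IsLinearizedNSSolutionOn S' ν u w q :=
  ⟨h.1.mono hS', h.2.1.mono hS', fun t ht => h.2.2.1 t (hS' ht), fun t ht => h.2.2.2.1 t (hS' ht),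
    fun _ ht x => linearisedNS_mono h.1 h.2.2.2.2 hS' hU ht x⟩

/-- **One-step `H → V` smoothing with `L²` growth along a bounded trajectory.** For `ν > 0`, a level `M` and
gradient levels `Cᵢ` there is `K ≥ 0` (depending only on `ν, M, C`) such that: along every classical solution `u`
of NS_ν(F) on `[0,∞) × T³` with `‖u(t,x)‖ ≤ M` and `‖∂ᵢu(t,x)‖ ≤ Cᵢ`, every linearised solution `(w, q)` on `[0,∞)`
satisfies `∫‖w(a+1)‖² + ‖∇w(a+1)‖₂² ≤ K ∫‖w(a)‖²` for every `a ≥ 0` — the parabolic smoothing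
`(t − a)‖∇w(t)‖₂² ≤ K₁ ∫‖w(a)‖²` of `Torus.linearisedNS_sub_mul_gradNormSq_le` on the window `[a, a+1]` (restricting
with `IsLinearizedNSSolutionOn.mono`, `Λ = max (∑ᵢCᵢ) 0`) plus the Grönwall bound
`∫‖w(a+1)‖² ≤ (∫‖w(a)‖²) e^{2∑ᵢCᵢ}` (`Torus.linearisedNS_integral_norm_sq_le_mul_exp_of_mem`); Constantin–Foias
1988 Ch. 14: "`S'(t,u₀)` maps `H` into `V` boundedly". [cite: ConstantinFoiasNSE1988, Ch. 14 (14.2)–(14.4) with Prop. 13.2] -/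
theorem exists_linearised_sq_add_gradNormSq_add_one_le (hν : 0 < ν) (M : ℝ) (C : Fin 3 → ℝ) :
    ∃ K : ℝ, 0 ≤ K ∧ ∀ {F : (UnitAddTorus (Fin 3)) → (EuclideanSpace ℝ (Fin 3))}
      {u : ℝ → (UnitAddTorus (Fin 3)) → (EuclideanSpace ℝ (Fin 3))} {p : ℝ → (UnitAddTorus (Fin 3)) → ℝ}
      {w : ℝ → (UnitAddTorus (Fin 3)) → (EuclideanSpace ℝ (Fin 3))} {q : ℝ → (UnitAddTorus (Fin 3)) → ℝ},
      IsClassicalNSSolutionOn (Ici 0) ν (fun _ => F) u p → (∀ t ∈ Ici (0 : ℝ), ∀ x, ‖u t x‖ ≤ M) →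
      (∀ i, ∀ t ∈ Ici (0 : ℝ), ∀ x, ‖partialDeriv i (u t) x‖ ≤ C i) → IsLinearizedNSSolutionOn (Ici 0) ν u w q →
      ∀ a : ℝ, 0 ≤ a → (∫ x, ‖w (a + 1) x‖ ^ 2) + gradNormSq (w (a + 1)) ≤ K * ∫ x, ‖w a x‖ ^ 2 := by
  set Λ : ℝ := max (∑ i, C i) 0 with hΛ
  have hΛ0 : 0 ≤ Λ := le_max_right _ _
  have hCΛ : ∑ i, C i ≤ Λ := le_max_left _ _
  set K₁ : ℝ := 2 * ((1 + 1 * (Fintype.card (Fin 3) * M ^ 2) / ν) / (4 * ν) +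
    (1 * Λ ^ 2 / (2 * ν) + 2 * ((1 + 1 * (Fintype.card (Fin 3) * M ^ 2) / ν) / (4 * ν)) * Λ) *
      1 * Real.exp (2 * Λ * 1)) with hK₁
  have hK₁0 : 0 ≤ K₁ := by positivity
  refine ⟨Real.exp (2 * ∑ i, C i) + K₁, by positivity, fun {F u p w q} hsol hM hC h a ha => ?_⟩
  have hlt : a < a + 1 := lt_add_one a
  have hsub : Icc a (a + 1) ⊆ Ici 0 := fun s hs => mem_Ici.2 (ha.trans hs.1)
  have hU : UniqueDiffOn ℝ (Icc a (a + 1)) := uniqueDiffOn_Icc hlt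
  have ht : a + 1 ∈ Icc a (a + 1) := right_mem_Icc.2 hlt.le
  have h' : IsLinearizedNSSolutionOn (Icc a (a + 1)) ν u w q := h.mono hsub hU
  -- `H → V` smoothing on the window `[a, a + 1]`
  have hV : (a + 1 - a) * gradNormSq (w (a + 1)) ≤ K₁ * ∫ x, ‖w a x‖ ^ 2 :=
    linearisedNS_sub_mul_gradNormSq_le hν hΛ0 one_pos (hsol.smooth_velocity.mono hsub)
      (fun s hs => hsol.divFree s (hsub hs)) h'.1 h'.2.1 h'.2.2.1 h'.2.2.2.2 (fun s hs x => hM s (hsub hs) x)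
      (fun i s hs x => hC i s (hsub hs) x) hCΛ ht
  -- `L²` growth from `a` to `a + 1`
  have hH : ∫ x, ‖w (a + 1) x‖ ^ 2 ≤ (∫ x, ‖w a x‖ ^ 2) * Real.exp ((2 * ∑ i, C i) * (a + 1 - a)) :=
    linearisedNS_integral_norm_sq_le_mul_exp_of_mem hν.le (convex_Ici 0) hsol.smooth_velocity
      (fun s hs => hsol.divFree s hs) h.1 h.2.1 h.2.2.1 h.2.2.2.2 hC (mem_Ici.2 ha) (hsub ht) hlt.le
  rw [add_sub_cancel_left, one_mul] at hV
  rw [add_sub_cancel_left, mul_one, mul_comm] at hH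
  rw [add_mul]
  exact add_le_add hH hV

/-- **Tools stub A2 — rate transfer between the `H` and `V` norms of the linearised flow (hyperbolicity transfer
N-A; registered stub `stub_linearisedRateTransferTools`, crux stmt-AnomalousDissipation-1143, line
`ergodic-budget-selection-closing`).**  Along a classical solution `u` of NS_ν(F) on `[0,∞) × T³` (`ν > 0`) with
bounded velocity `‖u‖ ≤ M` and gradients `‖∂ᵢu‖ ≤ Cᵢ` (the situation on the compact invariant core), for every
classical linearised solution `w`: exponential `L²` decay at integer times (`ExpDecay`) implies exponential decay of
the `H¹` quantity `‖w(n)‖₂² + ‖∇w(n)‖₂²` — the one-step `H → V` smoothing `‖w(n+1)‖₂² + ‖∇w(n+1)‖₂² ≤ K‖w(n)‖₂²`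
(`exists_linearised_sq_add_gradNormSq_add_one_le`) and `SeqExpDecay.of_succ_le` —, and sub-exponential growth of
the `H¹` quantity implies `SubExpGrowth w` (`SeqSubExpGrowth.of_le` with `‖w(n)‖₂² ≤ ‖w(n)‖₂² + ‖∇w(n)‖₂²`).  This
reads the cocycle hyperbolicity of the model measure (model norm = `V` norm) off the classical hypothesis (H)
(stated in `L²`); Barreira–Pesin 2023 Ch. 2 (Lyapunov exponents are insensitive to a one-step bounded change of
norm). [folklore] -/
theorem stub_linearisedRateTransferTools {ν : ℝ} (hν : 0 < ν) {F : (UnitAddTorus (Fin 3)) → (EuclideanSpace ℝ (Fin 3))}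
    {u : ℝ → (UnitAddTorus (Fin 3)) → (EuclideanSpace ℝ (Fin 3))} {p : ℝ → (UnitAddTorus (Fin 3)) → ℝ}
    (hsol : IsClassicalNSSolutionOn (Ici 0) ν (fun _ => F) u p) {M : ℝ} (hM : ∀ t ∈ Ici (0 : ℝ), ∀ x, ‖u t x‖ ≤ M)
    {C : Fin 3 → ℝ} (hC : ∀ i, ∀ t ∈ Ici (0 : ℝ), ∀ x, ‖partialDeriv i (u t) x‖ ≤ C i)
    {w : ℝ → (UnitAddTorus (Fin 3)) → (EuclideanSpace ℝ (Fin 3))} {q : ℝ → (UnitAddTorus (Fin 3)) → ℝ}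
    (h : IsLinearizedNSSolutionOn (Ici 0) ν u w q) :
    (ExpDecay w → SeqExpDecay (fun n : ℕ => (∫ x, ‖w n x‖ ^ 2) + gradNormSq (w n))) ∧
    (SeqSubExpGrowth (fun n : ℕ => (∫ x, ‖w n x‖ ^ 2) + gradNormSq (w n)) → SubExpGrowth w) := by
  obtain ⟨K, hK0, hK⟩ := exists_linearised_sq_add_gradNormSq_add_one_le hν M C
  have hstep : ∀ n : ℕ, (∫ x, ‖w ((n + 1 : ℕ) : ℝ) x‖ ^ 2) + gradNormSq (w ((n + 1 : ℕ) : ℝ)) ≤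
      K * ∫ x, ‖w n x‖ ^ 2 := fun n => by
    rw [Nat.cast_add_one]
    exact hK hsol hM hC h n (Nat.cast_nonneg n)
  refine ⟨fun hE => ?_, fun hS => ?_⟩
  · exact SeqExpDecay.of_succ_le (a := fun n : ℕ => (∫ x, ‖w n x‖ ^ 2) + gradNormSq (w n))
      (b := fun n : ℕ => ∫ x, ‖w n x‖ ^ 2) hE hK0 hstep
  · refine SeqSubExpGrowth.of_le (a := fun n : ℕ => ∫ x, ‖w n x‖ ^ 2) hS zero_le_one fun n => ?_
    rw [one_mul]
    exact le_add_of_nonneg_right (gradNormSq_nonneg _)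

end RateTransfer

end Summit.AnomalousDissipation.AnomalousDissipation.Theorems.DenseLoudDesignerForces.Ergodic

end
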